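import Literature.Topology.FourManifolds.HandleSlabLevel
import Literature.Topology.FourManifolds.CorkDecompositionSplittingProof
import Literature.Topology.FourManifolds.BoundaryFlowout
import Literature.Topology.FourManifolds.DehnSurgery
import HarnessLib

/-!
# The boundary pieces of `D⁴ ∪_h̄ H²`: the knot complement and the open solid torus

Topic `Literature/Topology/FourManifolds`; plumbing for Kirby 1989, Ch. I Lemma 2.1 (*"the boundary
of `D⁴` with a 2-handle attached along the framed knot `K` is the surgery on `K`"*) in the tree's
languages: Kosinski's attachments `HandleAttachingMap.IsMultiAttachment` (VI §6: `P` is glued from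
`D⁴ ∖ h̄(S)` and `D⁴ ∖ S`) on the 4-dimensional side, and the relational surgery
`IsIntegralSurgery`/`surgeryRel` (`DehnSurgery.lean`: `Y` glued from the knot complement
`S³ ∖ K` and the open solid torus `D̊² × S¹`) on the 3-dimensional side.  Restricting the two open
embeddings of `P = D⁴ ∪_h̄ H²` to the boundary (`OpenEmbeddingBoundaryRestrict.lean`) needs smooth
parametrisations of the boundaries of the two 4-dimensional pieces by the two 3-dimensional
pieces, with smooth left inverses; this file provides them:

* §1 **the knot complement parametrises `∂(D⁴ ∖ h̄(S))`**: for an attaching map `h̄` over `D⁴`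
  whose values on the unit disc bundle of `T ∩ ∂D⁴` are an oriented tubular neighbourhood `ν` of
  the knot `K` (the clause `carvedEmbed_handle` of `DottedCircleDiagram.Realization`), the core
  `h̄(S)` is `K ⊂ S³ = ∂D⁴` (`mem_core_iff_of_boundaryValues`), and `x ↦ incl x`
  (`HandleAttachingMap.complementPt`) maps `S³ ∖ K` into `D⁴ ∖ h̄(S)`: smooth, injective, onto the
  boundary, open onto the boundary, with the left inverse `HandleAttachingMap.complementInv`
  smooth on the boundary;
* §2 **the open solid torus parametrises `∂(D⁴ ∖ S)`**: `(u, w) ↦ (u, (1 - ‖u‖²)^{1/2} w)`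
  (`beltBoundaryPt : D̊² × S¹ → D⁴ ∖ S`, `x_λ = u`, `x_μ = (1 - ‖u‖²)^{1/2} w`), with the same five
  properties (left inverse `beltBoundaryInv : x ↦ (x_λ, x_μ/‖x_μ‖)`).

Everything here is proved; no named facts are introduced.

## References

* R. C. Kirby, *The Topology of 4-Manifolds*, LNM 1374 (1989), Ch. I §2, Lemma 2.1. [Kirby1989]
* A. A. Kosinski, *Differential Manifolds*, Academic Press (1993), VI §6. [Kosinski1993]
* D. Rolfsen, *Knots and Links* (1976), §9.F. [Rolfsen1976]
-/

open scoped Manifold ContDiff Topology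
open Set Function Metric Filter Real

noncomputable section

namespace Literature.Topology.FourManifolds

universe u

/-- Local notation: `𝔼 n` is the model Euclidean space `EuclideanSpace ℝ (Fin n)`. -/
local notation "𝔼 " n:arg => EuclideanSpace ℝ (Fin n)

/-- Local notation: `𝕊 n` is the unit sphere in `EuclideanSpace ℝ (Fin (n + 1))`. -/
local notation "𝕊 " n:arg => (Metric.sphere (0 : EuclideanSpace ℝ (Fin (n + 1))) 1)

/-- Local notation: `𝔻 n` is the closed unit ball in `EuclideanSpace ℝ (Fin n)`. -/
local notation "𝔻 " n:arg => (Metric.closedBall (0 : EuclideanSpace ℝ (Fin n)) 1)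

set_option quotPrecheck false in
/-- Local notation: Kosinski's tube `T ⊆ D⁴` of the circle `S¹ × 0`, as a type. -/
local notation "𝕋" => ↥(handleTube 3 2)

set_option quotPrecheck false in
/-- Local notation: the inclusion `S³ ↪ D⁴` of the boundary datum of the 4-disc. -/
local notation "ι₃" => (closedBallBoundaryData 3).incl

attribute [local instance] fact_finrank_euclideanSpace_succ

/-! ### §0 Boundary points of the pieces -/

/-- **Boundary points of `D⁴ ∖ S` are the points of norm `1`.** [folklore] -/
theorem mem_boundary_beltPiece_iff (b : ↥(beltPiece 3 2)) :
    b ∈ (𝓡∂ 4).boundary ↥(beltPiece 3 2) ↔ ‖(b.1 : 𝔼 4)‖ = 1 := by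
  rw [mem_boundary_opens_iff (beltPiece 3 2) b, boundary_closedBall]
  rfl

/-- The range of `ι₃` consists of the points of norm `1`. [folklore] -/
theorem mem_range_incl_iff (x : 𝔻 4) : x ∈ range ι₃ ↔ ‖(x : 𝔼 4)‖ = 1 := by
  rw [(closedBallBoundaryData 3).range_incl, boundary_closedBall]
  rfl

/-- `ι₃ x` as a vector is `x`. [folklore] -/
@[simp] theorem coe_incl_three (x : 𝕊 3) : ((ι₃ x : 𝔻 4) : 𝔼 4) = (x : 𝔼 4) := rfl

/-- The boundary sphere of `D⁴` is nonempty. [folklore] -/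
instance nonempty_closedBallBoundaryData_three_carrier : Nonempty (closedBallBoundaryData 3).carrier :=
  ⟨(⟨EuclideanSpace.single 0 1, by
    rw [mem_sphere_zero_iff_norm, PiLp.norm_single, norm_one]⟩ : 𝕊 3)⟩

namespace HandleAttachingMap

variable (g : HandleAttachingMap 3 2 (𝔻 4)) {K : Knot} (ν : Knot.TubularNbhd ⇑K)
  (hbd : ∀ y : 𝕋, tubeDepth y = 0 → g.toFun y = ι₃ (ν (tubeAngle y, tubeFibre y)))

/-! ### §1 The knot complement parametrises `∂(D⁴ ∖ h̄(S))` -/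

include hbd in
/-- **The attaching circle of `h̄` is the knot `K`, read in `D⁴`.** [cite: Kirby1989, Ch. I §2] -/
theorem apply_coreTubePt_eq (θ : 𝕊 1) : g.toFun (coreTubePt θ) = ι₃ (K θ) := by
  rw [hbd _ (tubeDepth_coreTubePt θ), tubeAngle_coreTubePt, tubeFibre_coreTubePt]
  exact congrArg _ (ν.apply_zero θ)

include hbd in
/-- **The core `h̄(S)` is `incl (K(S¹))`.** [cite: Kosinski1993, VI §6] -/
theorem mem_core_iff_of_boundaryValues (a : 𝔻 4) : a ∈ g.core ↔ ∃ θ, a = ι₃ (K θ) := by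
  rw [g.mem_core_iff]
  constructor
  · rintro ⟨y, hy, rfl⟩
    obtain ⟨θ, rfl⟩ := exists_coreTubePt_eq (y := y) hy
    exact ⟨θ, g.apply_coreTubePt_eq ν hbd θ⟩
  · rintro ⟨θ, rfl⟩
    exact ⟨coreTubePt θ, coreTubePt_mem_attachingSphereSet θ, g.apply_coreTubePt_eq ν hbd θ⟩

include hbd in
/-- **`incl x ∈ D⁴ ∖ h̄(S)` iff `x ∈ S³ ∖ K`.** [cite: Kosinski1993, VI §6] -/
theorem incl_mem_coresComplement_iff (x : 𝕊 3) :
    ι₃ x ∈ coresComplement (fun _ : Fin 1 => g) ↔ x ∉ range K := by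
  rw [mem_coresComplement]
  constructor
  · rintro h ⟨θ, rfl⟩
    exact h 0 ((g.mem_core_iff_of_boundaryValues ν hbd _).2 ⟨θ, rfl⟩)
  · intro h _ hc
    obtain ⟨θ, hθ⟩ := (g.mem_core_iff_of_boundaryValues ν hbd _).1 hc
    exact h ⟨θ, ((closedBallBoundaryData 3).injective_incl hθ).symm⟩

/-- **The parametrisation `S³ ∖ K → D⁴ ∖ h̄(S)`, `x ↦ incl x`.** [cite: Kirby1989, Ch. I §2] -/
def complementPt (x : ↥K.complement) : ↥(coresComplement (fun _ : Fin 1 => g)) :=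
  ⟨ι₃ x.1, (g.incl_mem_coresComplement_iff ν hbd x.1).2 x.2⟩

/-- Its value in `D⁴`. [folklore] -/
@[simp] theorem coe_complementPt (x : ↥K.complement) : (g.complementPt ν hbd x).1 = ι₃ x.1 := rfl

/-- It is smooth. [folklore] -/
theorem contMDiff_complementPt : ContMDiff (𝓡 3) (𝓡∂ 4) ∞ (g.complementPt ν hbd) := by
  rw [← ContMDiff.subtypeVal_comp_iff]
  exact (closedBallBoundaryData 3).isSmoothEmbedding.contMDiff.comp contMDiff_subtype_val

/-- It is injective. [folklore] -/
theorem injective_complementPt : Injective (g.complementPt ν hbd) := fun _ _ h =>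
  Subtype.ext ((closedBallBoundaryData 3).injective_incl (congrArg Subtype.val h))

/-- Its values are boundary points. [folklore] -/
theorem complementPt_mem_boundary (x : ↥K.complement) :
    g.complementPt ν hbd x ∈ (𝓡∂ 4).boundary ↥(coresComplement (fun _ : Fin 1 => g)) := by
  rw [mem_boundary_opens_iff, coe_complementPt, ← (closedBallBoundaryData 3).range_incl]
  exact mem_range_self _

/-- **Every boundary point of `D⁴ ∖ h̄(S)` comes from `S³ ∖ K`.** [folklore] -/
theorem mem_range_complementPt {a : ↥(coresComplement (fun _ : Fin 1 => g))}
    (ha : a ∈ (𝓡∂ 4).boundary ↥(coresComplement (fun _ : Fin 1 => g))) :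
    a ∈ range (g.complementPt ν hbd) := by
  rw [mem_boundary_opens_iff, ← (closedBallBoundaryData 3).range_incl] at ha
  obtain ⟨x, hx⟩ := ha
  have hx' : x ∉ range K := (g.incl_mem_coresComplement_iff ν hbd x).1 (hx ▸ a.2)
  exact ⟨⟨x, hx'⟩, Subtype.ext hx⟩

/-- **Images of open sets are open pieces of the boundary.** [folklore] -/
theorem exists_image_complementPt_eq {U : Set ↥K.complement} (hU : IsOpen U) :
    ∃ W : Set ↥(coresComplement (fun _ : Fin 1 => g)), IsOpen W ∧
      g.complementPt ν hbd '' U = W ∩ (𝓡∂ 4).boundary ↥(coresComplement (fun _ : Fin 1 => g)) := by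
  -- `U = val ⁻¹' U₁` with `U₁` open in `S³`, and `U₁ = ι₃ ⁻¹' W₀` with `W₀` open in `D⁴`
  obtain ⟨U₁, hU₁, rfl⟩ := isOpen_induced_iff.1 hU
  obtain ⟨W₀, hW₀, hW₀U⟩ := (closedBallBoundaryData 3).isSmoothEmbedding.isEmbedding.isInducing.isOpen_iff.1 hU₁
  refine ⟨Subtype.val ⁻¹' W₀, hW₀.preimage continuous_subtype_val, ?_⟩
  ext a
  constructor
  · rintro ⟨x, hx, rfl⟩
    refine ⟨?_, g.complementPt_mem_boundary ν hbd x⟩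
    show ι₃ x.1 ∈ W₀
    have : x.1 ∈ ι₃ ⁻¹' W₀ := by rw [hW₀U]; exact hx
    exact this
  · rintro ⟨haW, hab⟩
    obtain ⟨x, rfl⟩ := g.mem_range_complementPt ν hbd hab
    refine ⟨x, ?_, rfl⟩
    show x.1 ∈ U₁
    rw [← hW₀U]
    exact haW

open Classical in
/-- **The left inverse `D⁴ ∖ h̄(S) → S³ ∖ K`** (meaningful on the boundary): `incl⁻¹`, with junk
value the base point of `ν` off the good set. [folklore] -/
def complementInv (a : ↥(coresComplement (fun _ : Fin 1 => g))) : ↥K.complement :=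
  if h : (closedBallBoundaryData 3).inclInv a.1 ∉ range K then ⟨_, h⟩ else ν.basePoint

/-- `complementInv ∘ complementPt = id`. [folklore] -/
theorem complementInv_complementPt (x : ↥K.complement) :
    g.complementInv ν (g.complementPt ν hbd x) = x := by
  have h1 : (closedBallBoundaryData 3).inclInv (g.complementPt ν hbd x).1 = x.1 := by
    rw [coe_complementPt, (closedBallBoundaryData 3).inclInv_incl]
  have h2 : (closedBallBoundaryData 3).inclInv (g.complementPt ν hbd x).1 ∉ range K := by
    rw [h1]; exact x.2
  unfold complementInv
  rw [dif_pos h2]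
  exact Subtype.ext h1

include hbd in
/-- **The left inverse is smooth on the boundary.** [folklore] -/
theorem contMDiffOn_complementInv :
    ContMDiffOn (𝓡∂ 4) (𝓡 3) ∞ (g.complementInv ν)
      ((𝓡∂ 4).boundary ↥(coresComplement (fun _ : Fin 1 => g))) := by
  intro a ha
  rw [← ContMDiffWithinAt.subtypeVal_comp_iff]
  have hF : ContMDiffOn (𝓡∂ 4) (𝓡 3) ∞
      (fun a : ↥(coresComplement (fun _ : Fin 1 => g)) => (closedBallBoundaryData 3).inclInv a.1)
      ((𝓡∂ 4).boundary ↥(coresComplement (fun _ : Fin 1 => g))) := by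
    refine (closedBallBoundaryData 3).contMDiffOn_inclInv.comp contMDiff_subtype_val.contMDiffOn ?_
    intro a ha
    rw [mem_boundary_opens_iff, ← (closedBallBoundaryData 3).range_incl] at ha
    exact ha
  refine (hF a ha).congr (fun a' ha' => ?_) ?_
  · obtain ⟨x, rfl⟩ := g.mem_range_complementPt ν hbd ha'
    rw [comp_apply, g.complementInv_complementPt ν hbd, coe_complementPt,
      (closedBallBoundaryData 3).inclInv_incl]
  · obtain ⟨x, rfl⟩ := g.mem_range_complementPt ν hbd ha
    rw [comp_apply, g.complementInv_complementPt ν hbd, coe_complementPt,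
      (closedBallBoundaryData 3).inclInv_incl]

end HandleAttachingMap

/-! ### §2 The open solid torus parametrises `∂(D⁴ ∖ S)` -/

section SolidTorus

/-- The vector `(u, (1 - ‖u‖²)^{1/2} w) ∈ S³ ∖ S` of the point `(u, w) ∈ D̊² × S¹`. [folklore] -/
def beltBoundaryVec (b : ↥solidTorus) : 𝔼 4 :=
  lamEmbed b.1.1 + Real.sqrt (1 - ‖b.1.1‖ ^ 2) • muEmbed (b.1.2 : 𝔼 2)

/-- `‖u‖ < 1` on the open solid torus. [folklore] -/
theorem norm_fst_lt_one (b : ↥solidTorus) : ‖b.1.1‖ < 1 := (mem_solidTorus_iff _).1 b.2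

/-- `0 < 1 - ‖u‖²` on the open solid torus. [folklore] -/
theorem one_sub_norm_sq_pos (b : ↥solidTorus) : 0 < 1 - ‖b.1.1‖ ^ 2 := by
  have := norm_fst_lt_one b
  nlinarith [norm_nonneg b.1.1]

/-- The `λ`-part of `beltBoundaryVec b` is `u`. [folklore] -/
@[simp] theorem lamPart_beltBoundaryVec (b : ↥solidTorus) : lamPart (beltBoundaryVec b) = b.1.1 := by
  rw [beltBoundaryVec, lamPart_add, lamPart_lamEmbed, lamPart_smul, lamPart_muEmbed, smul_zero, add_zero]

/-- The `μ`-part of `beltBoundaryVec b` is `(1 - ‖u‖²)^{1/2} w`. [folklore] -/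
@[simp] theorem muPart_beltBoundaryVec (b : ↥solidTorus) :
    muPart (beltBoundaryVec b) = Real.sqrt (1 - ‖b.1.1‖ ^ 2) • (b.1.2 : 𝔼 2) := by
  rw [beltBoundaryVec, muPart_add, muPart_lamEmbed, muPart_smul, muPart_muEmbed, zero_add]

/-- `‖beltBoundaryVec b‖ = 1`. [folklore] -/
theorem norm_beltBoundaryVec (b : ↥solidTorus) : ‖beltBoundaryVec b‖ = 1 := by
  have h : ‖beltBoundaryVec b‖ ^ 2 = 1 := by
    rw [beltBoundaryVec, ← muEmbed_smul, norm_lamEmbed_add_muEmbed_sq, norm_smul, Real.norm_eq_abs,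
      abs_of_nonneg (Real.sqrt_nonneg _), norm_eq_of_mem_sphere b.1.2, mul_one,
      Real.sq_sqrt (one_sub_norm_sq_pos b).le]
    ring
  have h0 := norm_nonneg (beltBoundaryVec b)
  nlinarith

/-- `|beltBoundaryVec b|_λ² = ‖u‖² < 1`. [folklore] -/
theorem lamSq_beltBoundaryVec (b : ↥solidTorus) : lamSq 2 (beltBoundaryVec b) = ‖b.1.1‖ ^ 2 := by
  rw [← norm_lamPart_sq, lamPart_beltBoundaryVec]

/-- **The parametrisation `D̊² × S¹ → D⁴ ∖ S` of the boundary of the model handle piece.**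
[cite: Kirby1989, Ch. I §2] -/
def beltBoundaryPt (b : ↥solidTorus) : ↥(beltPiece 3 2) :=
  ⟨⟨beltBoundaryVec b, mem_closedBall_zero_iff.2 (norm_beltBoundaryVec b).le⟩, by
    rw [mem_beltPiece]
    show lamSq 2 (beltBoundaryVec b) ≠ 1
    rw [lamSq_beltBoundaryVec]
    have := norm_fst_lt_one b
    nlinarith [norm_nonneg b.1.1]⟩

/-- Its vector. [folklore] -/
@[simp] theorem coe_coe_beltBoundaryPt (b : ↥solidTorus) : ((beltBoundaryPt b).1 : 𝔼 4) = beltBoundaryVec b := rfl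

/-- It is smooth. [folklore] -/
theorem contMDiff_beltBoundaryPt : ContMDiff (𝓘(ℝ, 𝔼 2).prod (𝓡 1)) (𝓡∂ 4) ∞ beltBoundaryPt := by
  intro b
  apply contMDiffAt_beltPiece_mk
  show ContMDiffAt _ _ _ (fun z : ↥solidTorus => beltBoundaryVec z) b
  have hval : ContMDiff (𝓘(ℝ, 𝔼 2).prod (𝓡 1)) (𝓘(ℝ, 𝔼 2).prod (𝓡 1)) ∞
      (Subtype.val : ↥solidTorus → (𝔼 2) × (𝕊 1)) := contMDiff_subtype_val
  have h1 : ContMDiff (𝓘(ℝ, 𝔼 2).prod (𝓡 1)) 𝓘(ℝ, 𝔼 2) ∞ fun z : ↥solidTorus => z.1.1 :=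
    contMDiff_fst.comp hval
  have h2 : ContMDiff (𝓘(ℝ, 𝔼 2).prod (𝓡 1)) 𝓘(ℝ, 𝔼 2) ∞ fun z : ↥solidTorus => (z.1.2 : 𝔼 2) :=
    contMDiff_coe_sphere.comp (contMDiff_snd.comp hval)
  have h3 : ContMDiffAt (𝓘(ℝ, 𝔼 2).prod (𝓡 1)) 𝓘(ℝ, ℝ) ∞
      (fun z : ↥solidTorus => Real.sqrt (1 - ‖z.1.1‖ ^ 2)) b := by
    have h4 : ContMDiffAt (𝓘(ℝ, 𝔼 2).prod (𝓡 1)) 𝓘(ℝ, ℝ) ∞ (fun z : ↥solidTorus => 1 - ‖z.1.1‖ ^ 2) b :=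
      contMDiffAt_const.sub (((contDiff_norm_sq ℝ).contMDiff.comp h1) b)
    exact (Real.contDiffAt_sqrt (one_sub_norm_sq_pos b).ne').contMDiffAt.comp b h4
  exact ((contDiff_lamEmbed.contMDiff.comp h1) b).add (h3.smul ((contDiff_muEmbed.contMDiff.comp h2) b))

/-- It is injective. [folklore] -/
theorem injective_beltBoundaryPt : Injective beltBoundaryPt := fun b b' h => by
  have hv : beltBoundaryVec b = beltBoundaryVec b' := congrArg (fun p : ↥(beltPiece 3 2) => (p.1 : 𝔼 4)) h
  have h1 : b.1.1 = b'.1.1 := by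
    have := congrArg lamPart hv; rwa [lamPart_beltBoundaryVec, lamPart_beltBoundaryVec] at this
  have h2 : (b.1.2 : 𝔼 2) = b'.1.2 := by
    have := congrArg muPart hv
    rw [muPart_beltBoundaryVec, muPart_beltBoundaryVec, h1] at this
    exact smul_right_injective _ (Real.sqrt_pos.2 (one_sub_norm_sq_pos b')).ne' this
  exact Subtype.ext (Prod.ext h1 (Subtype.ext h2))

/-- Its values are boundary points. [folklore] -/
theorem beltBoundaryPt_mem_boundary (b : ↥solidTorus) :
    beltBoundaryPt b ∈ (𝓡∂ 4).boundary ↥(beltPiece 3 2) := by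
  rw [mem_boundary_beltPiece_iff]; exact norm_beltBoundaryVec b

/-- On the boundary of `D⁴ ∖ S`, `x_μ ≠ 0` and `‖x_λ‖ < 1`. [folklore] -/
theorem good_of_mem_boundary {b' : ↥(beltPiece 3 2)} (hb' : b' ∈ (𝓡∂ 4).boundary ↥(beltPiece 3 2)) :
    ‖lamPart (b'.1 : 𝔼 4)‖ < 1 ∧ muPart (b'.1 : 𝔼 4) ≠ 0 := by
  rw [mem_boundary_beltPiece_iff] at hb'
  have hl : lamSq 2 (b'.1 : 𝔼 4) < 1 := lt_of_le_of_ne (lamSq_le_one hb'.le) b'.2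
  have hsum := lamSq_add_muSq 2 (b'.1 : 𝔼 4)
  rw [hb', one_pow] at hsum
  refine ⟨?_, ?_⟩
  · have h := norm_lamPart_sq (b'.1 : 𝔼 4)
    nlinarith [norm_nonneg (lamPart (b'.1 : 𝔼 4))]
  · intro h0
    have := norm_muPart_sq (b'.1 : 𝔼 4)
    rw [h0, norm_zero] at this
    linarith

/-- A fixed unit vector of the plane. [folklore] -/
def unitVec₂ : 𝕊 1 := ⟨EuclideanSpace.single 0 1, by
  rw [mem_sphere_zero_iff_norm]; exact norm_single_zero_one⟩

/-- A fixed point of the open solid torus. [folklore] -/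
def solidTorusBasePt : ↥solidTorus := ⟨(0, unitVec₂), by rw [mem_solidTorus_iff, norm_zero]; exact one_pos⟩

open Classical in
/-- The normalised `μ`-part `x_μ/‖x_μ‖ ∈ S¹` (junk where `x_μ = 0`). [folklore] -/
def muDir (v : 𝔼 4) : 𝕊 1 :=
  if h : muPart v ≠ 0 then ⟨‖muPart v‖⁻¹ • muPart v, by
    rw [mem_sphere_zero_iff_norm, norm_smul, norm_inv, norm_norm, inv_mul_cancel₀ (norm_ne_zero_iff.2 h)]⟩
  else unitVec₂

/-- `muDir` on the good set. [folklore] -/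
theorem coe_muDir {v : 𝔼 4} (h : muPart v ≠ 0) : (muDir v : 𝔼 2) = ‖muPart v‖⁻¹ • muPart v := by
  rw [muDir, dif_pos h]

open Classical in
/-- **The left inverse `D⁴ ∖ S → D̊² × S¹`, `x ↦ (x_λ, x_μ/‖x_μ‖)`** (junk off the good set
`‖x_λ‖ < 1`, `x_μ ≠ 0`). [folklore] -/
def beltBoundaryInv (b' : ↥(beltPiece 3 2)) : ↥solidTorus :=
  if h : ‖lamPart (b'.1 : 𝔼 4)‖ < 1 then ⟨(lamPart (b'.1 : 𝔼 4), muDir (b'.1 : 𝔼 4)), by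
    rw [mem_solidTorus_iff]; exact h⟩
  else solidTorusBasePt

/-- The left inverse on the good set. [folklore] -/
theorem beltBoundaryInv_of_lt {b' : ↥(beltPiece 3 2)} (h : ‖lamPart (b'.1 : 𝔼 4)‖ < 1) :
    (beltBoundaryInv b').1 = (lamPart (b'.1 : 𝔼 4), muDir (b'.1 : 𝔼 4)) := by
  rw [beltBoundaryInv, dif_pos h]

/-- `beltBoundaryInv ∘ beltBoundaryPt = id`. [folklore] -/
theorem beltBoundaryInv_beltBoundaryPt (b : ↥solidTorus) : beltBoundaryInv (beltBoundaryPt b) = b := by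
  have hlt : ‖lamPart ((beltBoundaryPt b).1 : 𝔼 4)‖ < 1 := by
    rw [coe_coe_beltBoundaryPt, lamPart_beltBoundaryVec]; exact norm_fst_lt_one b
  have hr := Real.sqrt_pos.2 (one_sub_norm_sq_pos b)
  have hmu : muPart ((beltBoundaryPt b).1 : 𝔼 4) ≠ 0 := by
    rw [coe_coe_beltBoundaryPt, muPart_beltBoundaryVec]
    exact smul_ne_zero hr.ne' (ne_zero_of_mem_unit_sphere b.1.2)
  apply Subtype.ext
  rw [beltBoundaryInv_of_lt hlt]
  refine Prod.ext ?_ (Subtype.ext ?_)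
  · rw [coe_coe_beltBoundaryPt, lamPart_beltBoundaryVec]
  · show (muDir ((beltBoundaryPt b).1 : 𝔼 4) : 𝔼 2) = b.1.2
    rw [coe_muDir hmu, coe_coe_beltBoundaryPt, muPart_beltBoundaryVec, norm_smul, Real.norm_eq_abs,
      abs_of_pos hr, norm_eq_of_mem_sphere b.1.2, mul_one, smul_smul, inv_mul_cancel₀ hr.ne', one_smul]

/-- **Every boundary point of `D⁴ ∖ S` comes from the open solid torus.** [folklore] -/
theorem beltBoundaryPt_beltBoundaryInv {b' : ↥(beltPiece 3 2)} (hb' : b' ∈ (𝓡∂ 4).boundary ↥(beltPiece 3 2)) :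
    beltBoundaryPt (beltBoundaryInv b') = b' := by
  obtain ⟨hl, hmu⟩ := good_of_mem_boundary hb'
  rw [mem_boundary_beltPiece_iff] at hb'
  have hmn : 0 < ‖muPart (b'.1 : 𝔼 4)‖ := norm_pos_iff.2 hmu
  have hsq : Real.sqrt (1 - ‖lamPart (b'.1 : 𝔼 4)‖ ^ 2) = ‖muPart (b'.1 : 𝔼 4)‖ := by
    have hsum := norm_sq_eq_lamPart_muPart (b'.1 : 𝔼 4)
    rw [hb', one_pow] at hsum
    rw [show 1 - ‖lamPart (b'.1 : 𝔼 4)‖ ^ 2 = ‖muPart (b'.1 : 𝔼 4)‖ ^ 2 by linarith,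
      Real.sqrt_sq (norm_nonneg _)]
  apply Subtype.ext; apply Subtype.ext
  rw [coe_coe_beltBoundaryPt, beltBoundaryVec, beltBoundaryInv_of_lt hl]
  simp only
  rw [coe_muDir hmu, hsq, muEmbed_smul, smul_smul, mul_inv_cancel₀ hmn.ne', one_smul,
    lamEmbed_add_muEmbed]

/-- Boundary points of `D⁴ ∖ S` are in the range of `beltBoundaryPt`. [folklore] -/
theorem mem_range_beltBoundaryPt {b' : ↥(beltPiece 3 2)} (hb' : b' ∈ (𝓡∂ 4).boundary ↥(beltPiece 3 2)) :
    b' ∈ range beltBoundaryPt :=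
  ⟨_, beltBoundaryPt_beltBoundaryInv hb'⟩

/-- The good set `‖x_λ‖ < 1`, `x_μ ≠ 0` is open. [folklore] -/
theorem isOpen_good : IsOpen {b' : ↥(beltPiece 3 2) | ‖lamPart (b'.1 : 𝔼 4)‖ < 1 ∧ muPart (b'.1 : 𝔼 4) ≠ 0} :=
  (isOpen_lt (continuous_norm.comp (contDiff_lamPart.continuous.comp contMDiff_coe_beltPiece.continuous))
    continuous_const).inter
    (isOpen_ne.preimage (contDiff_muPart.continuous.comp contMDiff_coe_beltPiece.continuous))

/-- A map into the sphere is smooth on an open set if it is smooth there as a vector-valued map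
(local form of `ContMDiff.codRestrict_sphere`). [folklore] -/
theorem contMDiffOn_codRestrict_sphere' {F H : Type*} [NormedAddCommGroup F] [NormedSpace ℝ F]
    [TopologicalSpace H] {I : ModelWithCorners ℝ F H} {N : Type*} [TopologicalSpace N]
    [ChartedSpace H N] [IsManifold I ∞ N] {k : ℕ} {f : N → 𝔼 (k + 1)} {O : Set N} (hO : IsOpen O)
    (hf : ContMDiffOn I 𝓘(ℝ, 𝔼 (k + 1)) ∞ f O) (hf' : ∀ x, f x ∈ sphere (0 : 𝔼 (k + 1)) 1) :
    ContMDiffOn I (𝓡 k) ∞ (Set.codRestrict f _ hf') O := by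
  -- adapted from `contMDiffOn_codRestrict_sphere` (Literature/Topology/FourManifolds/RotationBody.lean)
  intro x hx
  set U : TopologicalSpace.Opens N := ⟨O, hO⟩
  have hg : ContMDiff I 𝓘(ℝ, 𝔼 (k + 1)) ∞ (f ∘ (Subtype.val : U → N)) :=
    hf.comp_contMDiff contMDiff_subtype_val fun y => y.2
  have hg' : ContMDiff I (𝓡 k) ∞ (Set.codRestrict (f ∘ (Subtype.val : U → N)) _ fun y => hf' y.1) :=
    hg.codRestrict_sphere _
  have h2 : ContMDiffAt I (𝓡 k) ∞ (fun y : U => Set.codRestrict f _ hf' y.1) ⟨x, hx⟩ := hg' ⟨x, hx⟩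
  exact (contMDiffAt_subtype_iff.1 h2).contMDiffWithinAt

/-- `muDir` is smooth on the good set, as a map on `D⁴ ∖ S`. [folklore] -/
theorem contMDiffOn_muDir :
    ContMDiffOn (𝓡∂ 4) (𝓡 1) ∞ (fun b' : ↥(beltPiece 3 2) => muDir (b'.1 : 𝔼 4))
      {b' | ‖lamPart (b'.1 : 𝔼 4)‖ < 1 ∧ muPart (b'.1 : 𝔼 4) ≠ 0} := by
  classical
  -- the vector-valued version with the same junk
  set f : ↥(beltPiece 3 2) → 𝔼 2 := fun b' => (muDir (b'.1 : 𝔼 4) : 𝔼 2) with hf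
  have hf' : ∀ b', f b' ∈ sphere (0 : 𝔼 2) 1 := fun b' => (muDir (b'.1 : 𝔼 4)).2
  have hfs : ContMDiffOn (𝓡∂ 4) 𝓘(ℝ, 𝔼 2) ∞ f
      {b' | ‖lamPart (b'.1 : 𝔼 4)‖ < 1 ∧ muPart (b'.1 : 𝔼 4) ≠ 0} := by
    have hmu : ContMDiff (𝓡∂ 4) 𝓘(ℝ, 𝔼 2) ∞ fun b' : ↥(beltPiece 3 2) => muPart (b'.1 : 𝔼 4) :=
      contDiff_muPart.contMDiff.comp contMDiff_coe_beltPiece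
    have h1 : ContMDiffOn (𝓡∂ 4) 𝓘(ℝ, 𝔼 2) ∞
        (fun b' : ↥(beltPiece 3 2) => ‖muPart (b'.1 : 𝔼 4)‖⁻¹ • muPart (b'.1 : 𝔼 4))
        {b' | ‖lamPart (b'.1 : 𝔼 4)‖ < 1 ∧ muPart (b'.1 : 𝔼 4) ≠ 0} := fun b' hb' =>
      ((((contDiffAt_norm ℝ hb'.2).contMDiffAt.comp b' (hmu b')).inv₀ (norm_ne_zero_iff.2 hb'.2)).smul
        (hmu b')).contMDiffWithinAt
    exact h1.congr fun b' hb' => coe_muDir hb'.2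
  have h := contMDiffOn_codRestrict_sphere' isOpen_good hfs hf'
  refine h.congr fun b' _ => ?_
  exact Subtype.ext rfl

/-- **The left inverse is smooth on the good set** (which contains the boundary). [folklore] -/
theorem contMDiffOn_beltBoundaryInv :
    ContMDiffOn (𝓡∂ 4) (𝓘(ℝ, 𝔼 2).prod (𝓡 1)) ∞ beltBoundaryInv
      {b' | ‖lamPart (b'.1 : 𝔼 4)‖ < 1 ∧ muPart (b'.1 : 𝔼 4) ≠ 0} := by
  intro b' hb'
  rw [← ContMDiffWithinAt.subtypeVal_comp_iff]
  have h1 : ContMDiff (𝓡∂ 4) 𝓘(ℝ, 𝔼 2) ∞ fun b' : ↥(beltPiece 3 2) => lamPart (b'.1 : 𝔼 4) :=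
    contDiff_lamPart.contMDiff.comp contMDiff_coe_beltPiece
  have h2 : ContMDiffOn (𝓡∂ 4) (𝓘(ℝ, 𝔼 2).prod (𝓡 1)) ∞
      (fun b' : ↥(beltPiece 3 2) => (lamPart (b'.1 : 𝔼 4), muDir (b'.1 : 𝔼 4)))
      {b' | ‖lamPart (b'.1 : 𝔼 4)‖ < 1 ∧ muPart (b'.1 : 𝔼 4) ≠ 0} :=
    h1.contMDiffOn.prodMk contMDiffOn_muDir
  refine (h2 b' hb').congr (fun b'' hb'' => beltBoundaryInv_of_lt hb''.1) (beltBoundaryInv_of_lt hb'.1)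

/-- The boundary lies in the good set. [folklore] -/
theorem boundary_subset_good :
    (𝓡∂ 4).boundary ↥(beltPiece 3 2) ⊆ {b' | ‖lamPart (b'.1 : 𝔼 4)‖ < 1 ∧ muPart (b'.1 : 𝔼 4) ≠ 0} :=
  fun _ hb' => good_of_mem_boundary hb'

/-- **Images of open sets are open pieces of the boundary**: `beltBoundaryPt '' U` is the trace on
the boundary of the open set `good ∩ beltBoundaryInv⁻¹ U`. [folklore] -/
theorem exists_image_beltBoundaryPt_eq {U : Set ↥solidTorus} (hU : IsOpen U) :
    ∃ W : Set ↥(beltPiece 3 2), IsOpen W ∧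
      beltBoundaryPt '' U = W ∩ (𝓡∂ 4).boundary ↥(beltPiece 3 2) := by
  refine ⟨{b' | ‖lamPart (b'.1 : 𝔼 4)‖ < 1 ∧ muPart (b'.1 : 𝔼 4) ≠ 0} ∩ beltBoundaryInv ⁻¹' U,
    contMDiffOn_beltBoundaryInv.continuousOn.isOpen_inter_preimage isOpen_good hU, ?_⟩
  ext b'
  constructor
  · rintro ⟨b, hb, rfl⟩
    refine ⟨⟨good_of_mem_boundary (beltBoundaryPt_mem_boundary b), ?_⟩, beltBoundaryPt_mem_boundary b⟩
    rw [mem_preimage, beltBoundaryInv_beltBoundaryPt]; exact hb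
  · rintro ⟨⟨-, hbU⟩, hb'⟩
    exact ⟨_, hbU, beltBoundaryPt_beltBoundaryInv hb'⟩

end SolidTorus

end Literature.Topology.FourManifolds
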